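import Literature.NumberTheory.Transcendental.EulerLehmerConstantsTranscendence
import HarnessLib

/-!
# Coinciding Euler–Lehmer constants would make `γ` a Baker period (Murty–Saradha 2010, §1)

Topic `Literature/NumberTheory/Transcendental`. Proofs only (no definitions, no named facts); sequel
of `EulerLehmerConstantsTranscendence.lean`.

M. Ram Murty and N. Saradha, *Euler–Lehmer constants and a conjecture of Erdős*, J. Number Theory
130 (2010) 2671–2682 [MurtySaradha2010], §1, after Corollary 2: «Are the elements of the above set of
Theorem 1 all distinct numbers? One can show that if any two elements above are equal, then `γ` is
a Baker period, that is, an element of the `ℚ̄`-vector space spanned by `1` and logarithms of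
algebraic numbers.» Here this is made explicit: by Gauss's formula (7)
(`digammaReal_add_eulerMascheroni_add_log`), `qγ(a,q) = γ − G(a,q)` with
`G(a,q) = −½cot(πa/q)·π + Σ_{n<q} cos(2πna/q) log(2 sin(πn/q))`, so `γ(a,q) = γ(b,r)` with
`(a,q) ≠ (b,r)` forces `q ≠ r` (for `q = r` the digamma is injective —
`digammaReal_lt_digammaReal`, «`ψ` is strictly increasing», Chatterjee–Gun 2014 Lemma 3.1) and then
**`γ = (r·G(a,q) − q·G(b,r))/(r − q)`**, an explicit `ℚ̄`-combination of `π = −i log(−1)` and of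
logarithms of the positive algebraic numbers `2 sin(πn/q)`, `2 sin(πm/r)`
(`eulerMascheroni_eq_of_eulerLehmer_eq`).

Cell pub-zeta5 (HONEST FRAMING: systematic search; no irrationality claim unless certified): a
printed remark made a kernel theorem; CONDITIONAL on a coincidence nobody expects; nothing here
concerns `ζ(5)` or decides the nature of `γ`.
-/

noncomputable section

open Complex Finset
open Literature.NumberTheory.Automorphic (digammaReal)
open Literature.NumberTheory.Automorphic.LegendreP (hasSum_inv_sub_inv_digammaReal
  digamma_ofReal_eq_digammaReal)

namespace Literature.NumberTheory.Transcendental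

namespace MurtySaradha2010

/-- **`ψ` is strictly increasing on `(0, ∞)`**: `0 < x < y ⇒ ψ(x) < ψ(y)` (termwise positivity of
`ψ(y) − ψ(x) = Σ_k (1/(x+k) − 1/(y+k))`, Andrews–Askey–Roy (1.2.13)).
[cite: ChatterjeeGun2014, Lemma 3.1] -/
theorem digammaReal_lt_digammaReal {x y : ℝ} (hx : 0 < x) (hxy : x < y) :
    digammaReal x < digammaReal y := by
  have h := hasSum_inv_sub_inv_digammaReal hx (sub_nonneg.2 hxy.le)
  rw [add_sub_cancel] at h
  have hpos : ∀ k : ℕ, 0 < 1 / (x + k) - 1 / (y + k) := by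
    intro k
    have hk : (0 : ℝ) ≤ k := k.cast_nonneg
    rw [sub_pos]
    exact one_div_lt_one_div_of_lt (by linarith) (by linarith)
  have := h.summable.tsum_pos (fun k => (hpos k).le) 0 (hpos 0)
  rw [h.tsum_eq] at this
  linarith

/-- **`ψ` is injective on the positive rationals**: `ψ(a/q) = ψ(b/r)` (`a, q, b, r ≥ 1`) forces
`a/q = b/r`. [cite: ChatterjeeGun2014, Lemma 3.1] -/
theorem div_eq_div_of_digamma_eq {a q b r : ℕ} (ha : 1 ≤ a) (hq : 1 ≤ q) (hb : 1 ≤ b) (hr : 1 ≤ r)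
    (h : Complex.digamma ((a : ℂ) / q) = Complex.digamma ((b : ℂ) / r)) : (a : ℝ) / q = b / r := by
  have hxa : (0 : ℝ) < a / q := div_pos (by exact_mod_cast ha) (by exact_mod_cast hq)
  have hxb : (0 : ℝ) < b / r := div_pos (by exact_mod_cast hb) (by exact_mod_cast hr)
  have ea : Complex.digamma ((a : ℂ) / q) = ((digammaReal ((a : ℝ) / q) : ℝ) : ℂ) := by
    rw [← digamma_ofReal_eq_digammaReal hxa]; push_cast; rfl
  have eb : Complex.digamma ((b : ℂ) / r) = ((digammaReal ((b : ℝ) / r) : ℝ) : ℂ) := by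
    rw [← digamma_ofReal_eq_digammaReal hxb]; push_cast; rfl
  rw [ea, eb] at h
  have hR : digammaReal ((a : ℝ) / q) = digammaReal ((b : ℝ) / r) := by exact_mod_cast h
  rcases lt_trichotomy ((a : ℝ) / q) ((b : ℝ) / r) with hlt | heq | hgt
  · exact absurd hR (digammaReal_lt_digammaReal hxa hlt).ne
  · exact heq
  · exact absurd hR (digammaReal_lt_digammaReal hxb hgt).ne'

/-- **If two Euler–Lehmer constants coincide, `γ` is an explicit Baker period.** For
`1 ≤ a < q`, `1 ≤ b < r` with `(a,q) ≠ (b,r)` and `γ(a,q) = γ(b,r)`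
(`γ(a,q) = −(ψ(a/q) + log q)/q`): then `q ≠ r` and
`γ = (r·G(a,q) − q·G(b,r))/(r − q)`, where
`G(a,q) = −½cot(πa/q)·π + Σ_{n=1}^{q−1} cos(2πna/q) log(2 sin(πn/q))` — a `ℚ̄`-linear combination of
`π` and of logarithms of positive algebraic numbers.
[cite: MurtySaradha2010, §1 («if any two elements above are equal, then γ is a Baker period»)] -/
theorem eulerMascheroni_eq_of_eulerLehmer_eq {a q b r : ℕ} (ha : 1 ≤ a) (haq : a < q) (hb : 1 ≤ b)
    (hbr : b < r) (hne : ¬ (a = b ∧ q = r))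
    (h : -(Complex.digamma ((a : ℂ) / q) + Real.log q) / q =
      -(Complex.digamma ((b : ℂ) / r) + Real.log r) / r) :
    q ≠ r ∧ Real.eulerMascheroniConstant =
      ((r : ℝ) * (-(1 / 2) * (Real.cos (Real.pi * a / q) / Real.sin (Real.pi * a / q)) * Real.pi +
          ∑ n ∈ Ico 1 q, Real.cos (2 * Real.pi * n * a / q) * Real.log (2 * Real.sin (Real.pi * n / q))) -
        (q : ℝ) * (-(1 / 2) * (Real.cos (Real.pi * b / r) / Real.sin (Real.pi * b / r)) * Real.pi +
          ∑ m ∈ Ico 1 r, Real.cos (2 * Real.pi * m * b / r) * Real.log (2 * Real.sin (Real.pi * m / r)))) /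
        ((r : ℝ) - q) := by
  have hq : 0 < q := by omega
  have hr : 0 < r := by omega
  have hqR : (q : ℝ) ≠ 0 := by exact_mod_cast hq.ne'
  have hrR : (r : ℝ) ≠ 0 := by exact_mod_cast hr.ne'
  have hxa : (0 : ℝ) < a / q := div_pos (by exact_mod_cast ha) (by exact_mod_cast hq)
  have hxb : (0 : ℝ) < b / r := div_pos (by exact_mod_cast hb) (by exact_mod_cast hr)
  have ea : Complex.digamma ((a : ℂ) / q) = ((digammaReal ((a : ℝ) / q) : ℝ) : ℂ) := by
    rw [← digamma_ofReal_eq_digammaReal hxa]; push_cast; rfl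
  have eb : Complex.digamma ((b : ℂ) / r) = ((digammaReal ((b : ℝ) / r) : ℝ) : ℂ) := by
    rw [← digamma_ofReal_eq_digammaReal hxb]; push_cast; rfl
  rw [ea, eb] at h
  have hR : -(digammaReal ((a : ℝ) / q) + Real.log q) / q = -(digammaReal ((b : ℝ) / r) + Real.log r) / r := by
    have h' : ((( -(digammaReal ((a : ℝ) / q) + Real.log q) / q : ℝ)) : ℂ) =
        ((( -(digammaReal ((b : ℝ) / r) + Real.log r) / r : ℝ)) : ℂ) := by
      push_cast at h ⊢; exact h
    exact_mod_cast h'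
  -- Gauss at both points: `ψ + γ + log = G`
  have hGa := digammaReal_add_eulerMascheroni_add_log ha haq
  have hGb := digammaReal_add_eulerMascheroni_add_log hb hbr
  set Ga := -(1 / 2) * (Real.cos (Real.pi * a / q) / Real.sin (Real.pi * a / q)) * Real.pi +
    ∑ n ∈ Ico 1 q, Real.cos (2 * Real.pi * n * a / q) * Real.log (2 * Real.sin (Real.pi * n / q)) with hGadef
  set Gb := -(1 / 2) * (Real.cos (Real.pi * b / r) / Real.sin (Real.pi * b / r)) * Real.pi +
    ∑ m ∈ Ico 1 r, Real.cos (2 * Real.pi * m * b / r) * Real.log (2 * Real.sin (Real.pi * m / r)) with hGbdef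
  -- `(r − q)·γ = r·Ga − q·Gb`
  have key : ((r : ℝ) - q) * Real.eulerMascheroniConstant = r * Ga - q * Gb := by
    have h1 : (r : ℝ) * (digammaReal ((a : ℝ) / q) + Real.log q) = q * (digammaReal ((b : ℝ) / r) + Real.log r) := by
      field_simp at hR
      linear_combination -hR
    linear_combination -h1 + (r : ℝ) * hGa - (q : ℝ) * hGb
  -- `q ≠ r`, by the injectivity of `ψ`
  have hqr : q ≠ r := by
    rintro rfl
    have h0 : digammaReal ((a : ℝ) / q) = digammaReal ((b : ℝ) / q) := by
      field_simp at hR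
      linarith
    have hdiv := div_eq_div_of_digamma_eq ha hq hb hq (by rw [ea, eb, h0])
    rw [div_eq_div_iff hqR hqR] at hdiv
    have : a = b := by exact_mod_cast (mul_right_cancel₀ hqR hdiv)
    exact hne ⟨this, rfl⟩
  refine ⟨hqr, ?_⟩
  have hrq : (r : ℝ) - q ≠ 0 := sub_ne_zero.2 (by exact_mod_cast (Ne.symm hqr))
  rw [eq_div_iff hrq]
  linear_combination key

end MurtySaradha2010

end Literature.NumberTheory.Transcendental
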